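import Summits.BirchSwinnertonDyer.BirchSwinnertonDyer.Theorems.AlignedTransportAtTwoMainConjectureOfRankZeroBSDAtTwoOrdinaryStandardShapeCrux
import HarnessLib

/-!
# Route `AlignedTransportAtTwo`, crux C2 `MainConjectureOfRankZeroBSDAtTwo` (stmt-BirchSwinnertonDyer-22298):
# THE REFINED SHAPE — `4 ∣ a₄` and `a₆` odd: every globally minimal curve good ordinary at `2` is `ℤ`-isomorphic (`u = 1`) to `[1, a₂, 0, 4b, a₆]`
# with `a₆` ODD; the named input may range over shape cubics `u³ + (1 + 4a₂)u² + 64bu + 64a₆`, `a₆` odd — and this is again EQUIVALENT to SHAPE / LOCAL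

HONEST FRAMING. WIDTH-5 attached prover seat `bsd-line-att-p4` g35 on line `birth` of the lead `bsd-line-att-p2` (WAKE-only); `--supports`
stmt-BirchSwinnertonDyer-22298, closes nothing; BSD is NOT proved; crux C2, its verdict «blocked-on `Rank1Residual.GreenbergMuConjectureIrreducible`»
and every registered stub untouched. THEOREMS ONLY (no `def`, no named fact, no `sorry`). §1–§2 UNCONDITIONAL; §3 CONDITIONAL on PRINT⁵ + MuIneqʳ as
displayed. Sequel of `…OrdinaryStandardShape{,Exact,Crux}` (this seat, same gen). Notation of the docstrings: SHAPE / LOCAL as in `…OrdinaryStandardShapeCrux`;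
SHAPE′ = «∀ `a₂ a₄ a₆ : ℤ` with `4 ∣ a₄`, `a₆` odd, `x³ + (1+4a₂)x² + 16a₄x + 64a₆` without rational root and `Δ[1,a₂,0,a₄,a₆] ∉ ℤ²`, every cubic number
field containing a root of it has narrow `μ₂⁺ = 0`» (two free integers `a₂`, `b = a₄/4` and an odd `a₆`).

* §1 `refine_standard` — the integral change `(1; −2a₄, 0, a₄)` carries `[1, a₂, 0, a₄, a₆]` to `[1, a₂ − 6a₄, 0, 4a₄(3a₄ − a₂), a₆ − a₄² + 4a₂a₄² − 8a₄³]`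
  (Silverman III.1 Table 3.1 — the `ℤ`-half of the DVR normal form `exists_smul_ordinaryNormalForm`); ★★ `exists_refinedShape_of_isOrdinaryAt` — for `W`
  globally minimal, good ordinary at `2`: integers `a₂, a₄, a₆, r` with **`4 ∣ a₄`, `a₆` odd**, `Δ[1,a₂,0,a₄,a₆] = Δ_min(W)` and `c_W(e) = 0 ⟺ g(e − 4r) = 0`.
* §2 ★★ `narrowMu_refinedShape_iff_standardShape`, `narrowMu_refinedShape_iff_localCell` — **SHAPE′ ⟺ SHAPE ⟺ LOCAL** (unconditional).
* §3 `crux_of_forall_refinedShape_cubicField_narrowClassicalMu` — SHAPE′ + PRINT⁵ + MuIneqʳ ⟹ C2 BY NAME.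
Expected REF2 grade: TEXTBOOK (Silverman III.1) + COROLLARY-OF-TREE. PARTITION: none; beyond-print theorem: no; BSD is NOT proved by any of this.

References: [SilvermanAEC2009] III.§1 Table 3.1, VIII.§8; [Kida1982JFields] Thm. 1, Remark (ii); [Greenberg2001IwasawaPastPresent] §4; [Kato2004Asterisque]
Thm. 17.4; [GreenbergLNM1716] Thm. 4.1; tree: `…OrdinaryStandardShape{,Exact,Crux}` (g35), `…NarrowCubicNamedInput` (g33).
-/

-- the Theorems namespace of this sub repeats the summit name by design (D-0017 nested layout)
set_option linter.dupNamespace false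
set_option autoImplicit false

noncomputable section

open scoped NumberField IntermediateField

namespace Summit.BirchSwinnertonDyer.BirchSwinnertonDyer.Theorems.AlignedTransportAtTwoOrdinaryStandardShapeRefined

open NumberField Polynomial WeierstrassCurve IntermediateField Field CongruenceSubgroup
  Literature.NumberTheory.EllipticCurves Literature.NumberTheory.EllipticCurves.Greenberg1999
  Literature.NumberTheory.EllipticCurves.ModularForms Literature.NumberTheory.EllipticCurves.Rank1Residual
  Literature.NumberTheory.EllipticCurves.Module
  Literature.NumberTheory.EllipticCurves.ZpExtension Literature.NumberTheory.GaloisRepresentations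
  Literature.NumberTheory.IwasawaTheory Literature.NumberTheory.NumberFields
  Summit.BirchSwinnertonDyer.Rank1Residual Summit.BirchSwinnertonDyer.Rank1Residual.X1.MuLambda
  Summit.BirchSwinnertonDyer.Rank1Residual.X5 Summit.BirchSwinnertonDyer.Rank1Residual.F1Sign2
  Summit.BirchSwinnertonDyer.BirchSwinnertonDyer.Theorems.Rank1ResidualX1Defs
  Summit.BirchSwinnertonDyer.BirchSwinnertonDyer.Theses.AlignedTransportAtTwo
  Summit.BirchSwinnertonDyer.BirchSwinnertonDyer.Theorems.AlignedTransportAtTwoNarrowCubicNamedInput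
  Summit.BirchSwinnertonDyer.BirchSwinnertonDyer.Theorems.AlignedTransportAtTwoOrdinaryStandardShape
  Summit.BirchSwinnertonDyer.BirchSwinnertonDyer.Theorems.AlignedTransportAtTwoOrdinaryStandardShapeExact
  Summit.BirchSwinnertonDyer.BirchSwinnertonDyer.Theorems.AlignedTransportAtTwoOrdinaryStandardShapeCrux

/-! ## §1 The refined normal form: `4 ∣ a₄`, `a₆` odd -/

section Refined

/-- **Refining a standard model over `ℤ`**: the integral change `(1; −2a₄, 0, a₄)` carries `[1, a₂, 0, a₄, a₆]` to
`[1, a₂ − 6a₄, 0, 4a₄(3a₄ − a₂), a₆ − a₄² + 4a₂a₄² − 8a₄³]` — again `a₁ = 1`, `a₃ = 0`, now with `4 ∣ a₄`. [cite: SilvermanAEC2009, III.§1 Table 3.1] -/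
theorem refine_standard (a₂ a₄ a₆ : ℤ) :
    (⟨1, -(2 * a₄), 0, a₄⟩ : VariableChange ℤ) • (⟨1, a₂, 0, a₄, a₆⟩ : WeierstrassCurve ℤ) =
      ⟨1, a₂ - 6 * a₄, 0, 4 * (a₄ * (3 * a₄ - a₂)), a₆ - a₄ ^ 2 + 4 * a₂ * a₄ ^ 2 - 8 * a₄ ^ 3⟩ := by
  ext
  all_goals simp only [variableChange_a₁, variableChange_a₂, variableChange_a₃, variableChange_a₄, variableChange_a₆,
    Units.val_one, inv_one, one_mul, one_pow]
  all_goals ring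

/-- `a₆ − a₄² + 4a₂a₄² − 8a₄³` is odd when `a₄ + a₆` is (`a₄² + a₄` is even). [folklore] -/
theorem odd_refined_a₆ {a₂ a₄ a₆ : ℤ} (h : Odd (a₄ + a₆)) : Odd (a₆ - a₄ ^ 2 + 4 * a₂ * a₄ ^ 2 - 8 * a₄ ^ 3) := by
  have h1 : Even (a₄ * (a₄ + 1)) := Int.even_mul_succ_self a₄
  have h2 : a₆ - a₄ ^ 2 + 4 * a₂ * a₄ ^ 2 - 8 * a₄ ^ 3 = (a₄ + a₆) - a₄ * (a₄ + 1) + 2 * (2 * a₂ * a₄ ^ 2 - 4 * a₄ ^ 3) := by ring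
  rw [h2]
  exact (h.sub_even h1).add_even (even_two_mul _)

variable (W : WeierstrassCurve ℚ) [W.IsElliptic] [W.IsGloballyMinimal]

/-- ★★ **THE REFINED SHAPE OF A CELL CURVE.** `W/ℚ` globally minimal and good ORDINARY at `2`. Then there are integers `a₂, a₄, a₆, r` with **`4 ∣ a₄` and
`a₆` ODD**, `Δ[1, a₂, 0, a₄, a₆] = Δ_min(W)`, and `c_W(e) = 0 ⟺ (e − 4r)³ + (1 + 4a₂)(e − 4r)² + 16a₄(e − 4r) + 64a₆ = 0` in every field of characteristic `0`
(the standard model of `…OrdinaryStandardShape`, refined by `(1; −2a₄, 0, a₄)`; the `u`-cubic moves by a further translation `u ↦ u + 8a₄`).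
[cite: SilvermanAEC2009, III.§1 Table 3.1, V.§4, VII.§1] -/
theorem exists_refinedShape_of_isOrdinaryAt (hord : IsOrdinaryAt W 2) :
    ∃ a₂ a₄ a₆ r : ℤ, 4 ∣ a₄ ∧ Odd a₆ ∧ (⟨1, a₂, 0, a₄, a₆⟩ : WeierstrassCurve ℤ).Δ = minimalDiscriminantInt W ∧
      ∀ {K : Type} [Field K] [CharZero K] [Algebra ℚ K] (e : K),
        aeval e (twoDivisionUCubic W) = 0 ↔
          (e - 4 * (r : K)) ^ 3 + (1 + 4 * (a₂ : K)) * (e - 4 * (r : K)) ^ 2 + 16 * (a₄ : K) * (e - 4 * (r : K)) + 64 * (a₆ : K) = 0 := by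
  obtain ⟨a₂, a₄, a₆, r, hodd, hΔ, hroot⟩ := exists_standardShape_of_isOrdinaryAt W hord
  have hM := refine_standard a₂ a₄ a₆
  refine ⟨a₂ - 6 * a₄, 4 * (a₄ * (3 * a₄ - a₂)), a₆ - a₄ ^ 2 + 4 * a₂ * a₄ ^ 2 - 8 * a₄ ^ 3, r - 2 * a₄, ⟨_, rfl⟩,
    odd_refined_a₆ hodd, ?_, ?_⟩
  · rw [← hM, Δ_smul_of_u_eq_one _ _ rfl, hΔ]
  · intro K _ _ _ e
    have key := cubic_eq_shape_translate (⟨1, a₂, 0, a₄, a₆⟩ : WeierstrassCurve ℤ) (⟨1, -(2 * a₄), 0, a₄⟩ : VariableChange ℤ) rfl hM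
      (e - 4 * (r : K))
    simp only [WeierstrassCurve.b₂, WeierstrassCurve.b₄, WeierstrassCurve.b₆] at key
    push_cast at key
    have hg : (e - 4 * (r : K)) ^ 3 + (1 + 4 * (a₂ : K)) * (e - 4 * (r : K)) ^ 2 + 16 * (a₄ : K) * (e - 4 * (r : K)) + 64 * (a₆ : K) =
        (e - 4 * ((r - 2 * a₄ : ℤ) : K)) ^ 3 + (1 + 4 * ((a₂ - 6 * a₄ : ℤ) : K)) * (e - 4 * ((r - 2 * a₄ : ℤ) : K)) ^ 2 +
          16 * ((4 * (a₄ * (3 * a₄ - a₂)) : ℤ) : K) * (e - 4 * ((r - 2 * a₄ : ℤ) : K)) +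
            64 * ((a₆ - a₄ ^ 2 + 4 * a₂ * a₄ ^ 2 - 8 * a₄ ^ 3 : ℤ) : K) := by
      push_cast
      linear_combination key
    rw [hroot e, hg]

end Refined

/-! ## §2 SHAPE′ ⟺ SHAPE ⟺ LOCAL (unconditional) -/

section Equivalence

/-- **SHAPE′ ⟹ LOCAL** (through the refined shape of a cell curve). UNCONDITIONAL; nothing asserted about either side.
[cite: SilvermanAEC2009, III.§1 Table 3.1 and VIII.§8] [cite: Kida1982JFields, Remark (ii) (p. 341)] -/
theorem localCell_of_narrowMu_refinedShape
    (hS : ∀ a₂ a₄ a₆ : ℤ, 4 ∣ a₄ → Odd a₆ →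
      (∀ x : ℚ, x ^ 3 + (1 + 4 * (a₂ : ℚ)) * x ^ 2 + 16 * (a₄ : ℚ) * x + 64 * (a₆ : ℚ) ≠ 0) →
      ¬ IsSquare (⟨1, a₂, 0, a₄, a₆⟩ : WeierstrassCurve ℤ).Δ →
      ∀ (F : Type) [Field F] [NumberField F], Module.finrank ℚ F = 3 →
      ∀ e : F, e ^ 3 + (1 + 4 * (a₂ : F)) * e ^ 2 + 16 * (a₄ : F) * e + 64 * (a₆ : F) = 0 →
      (∀ κ : ZpExtension F 2, κ.IsCyclotomic → ClassicalMuVanishes κ) ∧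
        ∃ D : ℕ, ∀ κ : ZpExtension F 2, κ.IsCyclotomic → ∀ n : ℕ, ∀ [NumberField ↥(κ.layer n)],
          padicValNat 2 (narrowClassNumber ↥(κ.layer n)) ≤ padicValNat 2 (classNumber ↥(κ.layer n)) + D) :
    ∀ (W : WeierstrassCurve ℚ) [W.IsElliptic] [W.IsGloballyMinimal], IsOrdinaryAt W 2 →
      (∀ x : ℚ, ¬ HasRationalTwoTorsionX W x) → ¬ IsSquare W.Δ →
      ∀ (F : Type) [Field F] [NumberField F], Module.finrank ℚ F = 3 → ∀ e : F, aeval e (twoDivisionUCubic W) = 0 →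
      (∀ κ : ZpExtension F 2, κ.IsCyclotomic → ClassicalMuVanishes κ) ∧
        ∃ D : ℕ, ∀ κ : ZpExtension F 2, κ.IsCyclotomic → ∀ n : ℕ, ∀ [NumberField ↥(κ.layer n)],
          padicValNat 2 (narrowClassNumber ↥(κ.layer n)) ≤ padicValNat 2 (classNumber ↥(κ.layer n)) + D := by
  intro W _ _ hord ht hsq F _ _ hF e he
  obtain ⟨a₂, a₄, a₆, r, h4, hodd, hΔ, hroot⟩ := exists_refinedShape_of_isOrdinaryAt W hord
  have hnsq : ¬ IsSquare (⟨1, a₂, 0, a₄, a₆⟩ : WeierstrassCurve ℤ).Δ := by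
    rw [hΔ]
    rintro ⟨s, hs⟩
    exact hsq ⟨s, by rw [← cast_minimalDiscriminantInt W, hs]; push_cast; ring⟩
  exact hS a₂ a₄ a₆ h4 hodd (shape_ne_zero_of_forall_not_hasRationalTwoTorsionX W ht hroot) hnsq F hF (e - 4 * (r : F))
    ((hroot e).mp he)

/-- ★★ **SHAPE′ ⟺ SHAPE**: restricting the integer-triple named input to `4 ∣ a₄`, `a₆` odd loses nothing (SHAPE′ ⟹ LOCAL ⟹ SHAPE by the exact image;
SHAPE ⟹ SHAPE′ since `4 ∣ a₄`, `a₆` odd ⟹ `a₄ + a₆` odd). UNCONDITIONAL; both sides OPEN IN PRINT; nothing asserted about them.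
[cite: SilvermanAEC2009, III.§1 Table 3.1 and VIII.§8 Cor. 8.3] [cite: Greenberg2001IwasawaPastPresent, §4] [cite: Kida1982JFields, Thm. 1 and Remark (ii)] -/
theorem narrowMu_refinedShape_iff_standardShape :
    (∀ a₂ a₄ a₆ : ℤ, 4 ∣ a₄ → Odd a₆ →
      (∀ x : ℚ, x ^ 3 + (1 + 4 * (a₂ : ℚ)) * x ^ 2 + 16 * (a₄ : ℚ) * x + 64 * (a₆ : ℚ) ≠ 0) →
      ¬ IsSquare (⟨1, a₂, 0, a₄, a₆⟩ : WeierstrassCurve ℤ).Δ →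
      ∀ (F : Type) [Field F] [NumberField F], Module.finrank ℚ F = 3 →
      ∀ e : F, e ^ 3 + (1 + 4 * (a₂ : F)) * e ^ 2 + 16 * (a₄ : F) * e + 64 * (a₆ : F) = 0 →
      (∀ κ : ZpExtension F 2, κ.IsCyclotomic → ClassicalMuVanishes κ) ∧
        ∃ D : ℕ, ∀ κ : ZpExtension F 2, κ.IsCyclotomic → ∀ n : ℕ, ∀ [NumberField ↥(κ.layer n)],
          padicValNat 2 (narrowClassNumber ↥(κ.layer n)) ≤ padicValNat 2 (classNumber ↥(κ.layer n)) + D) ↔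
    (∀ a₂ a₄ a₆ : ℤ, Odd (a₄ + a₆) →
      (∀ x : ℚ, x ^ 3 + (1 + 4 * (a₂ : ℚ)) * x ^ 2 + 16 * (a₄ : ℚ) * x + 64 * (a₆ : ℚ) ≠ 0) →
      ¬ IsSquare (⟨1, a₂, 0, a₄, a₆⟩ : WeierstrassCurve ℤ).Δ →
      ∀ (F : Type) [Field F] [NumberField F], Module.finrank ℚ F = 3 →
      ∀ e : F, e ^ 3 + (1 + 4 * (a₂ : F)) * e ^ 2 + 16 * (a₄ : F) * e + 64 * (a₆ : F) = 0 →
      (∀ κ : ZpExtension F 2, κ.IsCyclotomic → ClassicalMuVanishes κ) ∧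
        ∃ D : ℕ, ∀ κ : ZpExtension F 2, κ.IsCyclotomic → ∀ n : ℕ, ∀ [NumberField ↥(κ.layer n)],
          padicValNat 2 (narrowClassNumber ↥(κ.layer n)) ≤ padicValNat 2 (classNumber ↥(κ.layer n)) + D) := by
  constructor
  · intro hS'
    exact narrowMu_standardShape_of_localCell (fun W _ _ ↦ localCell_of_narrowMu_refinedShape hS' W)
  · intro hS a₂ a₄ a₆ h4 hodd
    exact hS a₂ a₄ a₆ ((even_iff_two_dvd.mpr (dvd_trans ⟨2, by norm_num⟩ h4)).add_odd hodd)

/-- ★★ **SHAPE′ ⟺ LOCAL**: the named input on two free integers `a₂`, `a₄/4` and an odd `a₆` is EQUIVALENT to C2's curve-indexed local input.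
UNCONDITIONAL; both sides OPEN IN PRINT; nothing asserted about them. [cite: SilvermanAEC2009, III.§1 Table 3.1 and VIII.§8 Cor. 8.3] [cite: Neron1964]
[cite: Greenberg2001IwasawaPastPresent, §4] -/
theorem narrowMu_refinedShape_iff_localCell :
    (∀ a₂ a₄ a₆ : ℤ, 4 ∣ a₄ → Odd a₆ →
      (∀ x : ℚ, x ^ 3 + (1 + 4 * (a₂ : ℚ)) * x ^ 2 + 16 * (a₄ : ℚ) * x + 64 * (a₆ : ℚ) ≠ 0) →
      ¬ IsSquare (⟨1, a₂, 0, a₄, a₆⟩ : WeierstrassCurve ℤ).Δ →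
      ∀ (F : Type) [Field F] [NumberField F], Module.finrank ℚ F = 3 →
      ∀ e : F, e ^ 3 + (1 + 4 * (a₂ : F)) * e ^ 2 + 16 * (a₄ : F) * e + 64 * (a₆ : F) = 0 →
      (∀ κ : ZpExtension F 2, κ.IsCyclotomic → ClassicalMuVanishes κ) ∧
        ∃ D : ℕ, ∀ κ : ZpExtension F 2, κ.IsCyclotomic → ∀ n : ℕ, ∀ [NumberField ↥(κ.layer n)],
          padicValNat 2 (narrowClassNumber ↥(κ.layer n)) ≤ padicValNat 2 (classNumber ↥(κ.layer n)) + D) ↔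
    (∀ (W : WeierstrassCurve ℚ) [W.IsElliptic] [W.IsGloballyMinimal], IsOrdinaryAt W 2 →
      (∀ x : ℚ, ¬ HasRationalTwoTorsionX W x) → ¬ IsSquare W.Δ →
      ∀ (F : Type) [Field F] [NumberField F], Module.finrank ℚ F = 3 → ∀ e : F, aeval e (twoDivisionUCubic W) = 0 →
      (∀ κ : ZpExtension F 2, κ.IsCyclotomic → ClassicalMuVanishes κ) ∧
        ∃ D : ℕ, ∀ κ : ZpExtension F 2, κ.IsCyclotomic → ∀ n : ℕ, ∀ [NumberField ↥(κ.layer n)],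
          padicValNat 2 (narrowClassNumber ↥(κ.layer n)) ≤ padicValNat 2 (classNumber ↥(κ.layer n)) + D) :=
  narrowMu_refinedShape_iff_standardShape.trans narrowMu_standardShape_iff_localCell

end Equivalence

/-! ## §3 C2 BY NAME from SHAPE′ + PRINT⁵ + MuIneqʳ -/

section Cell

/-- **SHAPE′ + PRINT⁵ + MuIneqʳ ⟹ C2 BY NAME** (granted Kato 17.4 (1)(2) at `2` `h17`, Greenberg 4.1 `hGr`, period unit `hper`, modularity `hmod`, GZK `hGZK`,
and the registered stub MuIneqʳ verbatim `hI`): IF for all integers `a₂, a₄, a₆` with `4 ∣ a₄`, `a₆` odd, `x³ + (1+4a₂)x² + 16a₄x + 64a₆` without rational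
root and `Δ[1,a₂,0,a₄,a₆] ∉ ℤ²`, every cubic number field containing a root of it has narrow `μ₂⁺ = 0`, THEN `MainConjectureOfRankZeroBSDAtTwo`. OPEN IN
PRINT; nothing asserted about the hypothesis. CONDITIONAL; nothing closed; BSD is NOT proved. [cite: Greenberg2001IwasawaPastPresent, §4 (Iwasawa's μ = 0 conjecture)]
[cite: Kida1982JFields, Thm. 1 (p. 340) and Remark (ii) (p. 341)] [cite: Kato2004Asterisque, Thm. 17.4 (p. 273) and §17.13 (pp. 279–280)]
[cite: GreenbergLNM1716, Thm. 4.1 (p. 102) and Conj. 1.11 (p. 58)] -/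
theorem crux_of_forall_refinedShape_cubicField_narrowClassicalMu
    (h17 : ∀ (V : WeierstrassCurve ℚ) [V.IsElliptic] [V.IsGloballyMinimal] [NeZero (V.conductorNorm ℤ)]
      (f : CuspForm (Gamma0 (V.conductorNorm ℤ)) 2), kato_divisibility_allPrimes V 2 (f := f))
    (hGr : Greenberg1999.thm41_charValue_rankZero_anyPrime)
    (hper : realPeriodRat_eq_unit_mul_plusPeriod_two) (hmod : nonempty_modularParametrizationData)
    (hGZK : rank_eq_analyticRank_of_analyticRank_le_one)
    (hI : ∀ (W : WeierstrassCurve ℚ) [W.IsElliptic] [W.IsGloballyMinimal], IsOrdinaryAt W 2 →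
      (∀ x : ℚ, ¬ HasRationalTwoTorsionX W x) →
      ∀ (κ : ZpExtension ℚ 2) (γ : Field.absoluteGaloisGroup ℚ), κ.IsCyclotomic →
      κ.IsTopGenerator γ → IsCyclotomicVariable 2 γ →
      ∀ ⦃N : ℕ⦄ [NeZero N] (f : CuspForm (Gamma0 N) 2), IsNewformOf W f →
      ∀ Gp : IwasawaAlgebra 2, iwasawaToPowerSeries 2 Gp = padicLFunction f (unitRoot W 2 : ℚ_[2]) →
      ∀ (D : W.SelmerDualData κ γ) (Yr : W.FineSelmerDualDataRelaxedInf κ γ),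
        lengthAt (IwasawaAlgebra 2) D.X ⟨IwasawaAlgebra.augIdealP 2, IwasawaAlgebra.isPrime_augIdealP_holds 2⟩ ≤
          lengthAt (IwasawaAlgebra 2) (IwasawaAlgebra 2 ⧸ Ideal.span {Gp})
              ⟨IwasawaAlgebra.augIdealP 2, IwasawaAlgebra.isPrime_augIdealP_holds 2⟩ +
            lengthAt (IwasawaAlgebra 2) Yr.X ⟨IwasawaAlgebra.augIdealP 2, IwasawaAlgebra.isPrime_augIdealP_holds 2⟩)
    (hS : ∀ a₂ a₄ a₆ : ℤ, 4 ∣ a₄ → Odd a₆ →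
      (∀ x : ℚ, x ^ 3 + (1 + 4 * (a₂ : ℚ)) * x ^ 2 + 16 * (a₄ : ℚ) * x + 64 * (a₆ : ℚ) ≠ 0) →
      ¬ IsSquare (⟨1, a₂, 0, a₄, a₆⟩ : WeierstrassCurve ℤ).Δ →
      ∀ (F : Type) [Field F] [NumberField F], Module.finrank ℚ F = 3 →
      ∀ e : F, e ^ 3 + (1 + 4 * (a₂ : F)) * e ^ 2 + 16 * (a₄ : F) * e + 64 * (a₆ : F) = 0 →
      (∀ κ : ZpExtension F 2, κ.IsCyclotomic → ClassicalMuVanishes κ) ∧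
        ∃ D : ℕ, ∀ κ : ZpExtension F 2, κ.IsCyclotomic → ∀ n : ℕ, ∀ [NumberField ↥(κ.layer n)],
          padicValNat 2 (narrowClassNumber ↥(κ.layer n)) ≤ padicValNat 2 (classNumber ↥(κ.layer n)) + D) :
    MainConjectureOfRankZeroBSDAtTwo :=
  crux_of_forall_cubicField_root_narrowClassicalMu h17 hGr hper hmod hGZK hI
    (fun W _ _ _ hord ht hsq _ _ F _ _ hF e he ↦ localCell_of_narrowMu_refinedShape hS W hord ht hsq F hF e he)

end Cell

end Summit.BirchSwinnertonDyer.BirchSwinnertonDyer.Theorems.AlignedTransportAtTwoOrdinaryStandardShapeRefined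

end
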